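import Literature.AlgebraicGeometry.Motives.BaseChange
import Literature.AlgebraicGeometry.Motives.AlgPointsProofs
import HarnessLib

/-!
# Complex points of a conjugate variety and values of conjugated regular functions

For a field automorphism `σ ∈ Aut ℂ` and a `ℂ`-scheme `Y`, the conjugate variety
`Y^σ = Y ×_{Spec ℂ, Spec σ} Spec ℂ` (`Motives.conjugateVariety σ Y`, Deligne's `σY`) comes with the
first projection `π : Y^σ ⟶ Y` (`Motives.baseChangeHomFst`, here `conjFst σ Y`), an isomorphism
of ABSTRACT schemes which is `σ`-semilinear over the base. This file proves the point-level
dictionary used to compare regular functions on `Y` with their conjugates `π^* a` on `Y^σ`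
(Charles–Schnell, *Notes on absolute Hodge classes*, §11.2.2, (11.2.1): "`σ⁻¹ : X^σ → X`, an
isomorphism of abstract schemes … `σ`-linear"):

* `AlgPoints.ofConjugate σ Y y'` — the complex point `y = π ∘ y' ∘ Spec(σ⁻¹)` of `Y` under a
  complex point `y'` of `Y^σ` (the twist by `Spec(σ⁻¹)` makes it a `ℂ`-point over `Spec ℂ`);
* `AlgPoints.pt_ofConjugate` — it lies over `π(y')`, so `y ∈ V ↔ y' ∈ π⁻¹V`;
* `AlgPoints.eval_app_conjFst` — **values transform by `σ`**: `(π^* a)(y') = σ (a(y))` for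
  `a ∈ Γ(Y, V)`, with total versions `evalOrZero_app_conjFst`, `evalOrZero_appTop_conjFst`.

So a conjugated regular function, read on complex points, is `σ ∘ a ∘ (y' ↦ y)`: the
scheme-theoretic content of "the equations of `Y^σ` are the `σ`-conjugates of those of `Y`".
Auxiliary: `ΓSpecIso_hom_appLE_specMap_comp` (pulling a value back along `Spec τ ≫ g` twists it
by `τ`), `appLE_comp_eq` (values along `g ≫ π`).

## References

* F. Charles, C. Schnell, *Notes on absolute Hodge classes* (2014), §11.2.2, (11.2.1).
* P. Deligne, *Hodge cycles on abelian varieties*, LNM 900 (1982), §1 (conventions for `σX`).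
* R. Hartshorne, *Algebraic Geometry*, II Ex. 2.7, II.3 (base extension).
-/

noncomputable section

open CategoryTheory CategoryTheory.Limits AlgebraicGeometry

namespace Literature.AlgebraicGeometry.Motives

/-! ### Values of sections pulled back to `Spec ℂ` -/

section SpecValues

/-- Pulling back along `Spec τ ≫ g` twists the value (in `Γ(Spec ℂ) = ℂ`) of a section by `τ`:
naturality of `Γ(Spec R) ≅ R` (Mathlib `Scheme.ΓSpecIso_naturality`). [folklore] -/
theorem ΓSpecIso_hom_appLE_specMap_comp {Z : Scheme} (g : Spec (.of ℂ) ⟶ Z) (τ : ℂ →+* ℂ)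
    (U : Z.Opens) (e : (⊤ : (Spec (.of ℂ)).Opens) ≤ g ⁻¹ᵁ U)
    (e' : (⊤ : (Spec (.of ℂ)).Opens) ≤ (Spec.map (CommRingCat.ofHom τ) ≫ g) ⁻¹ᵁ U) (f : Γ(Z, U)) :
    (Scheme.ΓSpecIso (.of ℂ)).hom ((Spec.map (CommRingCat.ofHom τ) ≫ g).appLE U ⊤ e' f) =
      τ ((Scheme.ΓSpecIso (.of ℂ)).hom (g.appLE U ⊤ e f)) := by
  -- split the composite
  have hc := Scheme.Hom.appLE_comp_appLE (Spec.map (CommRingCat.ofHom τ)) g U ⊤ ⊤ e le_top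
  have h1 : (Spec.map (CommRingCat.ofHom τ) ≫ g).appLE U ⊤ e' f =
      (Spec.map (CommRingCat.ofHom τ)).appLE ⊤ ⊤ le_top (g.appLE U ⊤ e f) := by
    rw [← CommRingCat.comp_apply, hc]
  -- `appLE ⊤ ⊤` of `Spec τ` is `appTop`
  have h2 : (Spec.map (CommRingCat.ofHom τ)).appLE ⊤ ⊤ le_top =
      (Spec.map (CommRingCat.ofHom τ)).appTop := by
    rw [Scheme.Hom.appTop, Scheme.Hom.app_eq_appLE]
    rfl
  -- naturality of `ΓSpecIso`
  have h3 : ∀ z : Γ(Spec (.of ℂ), ⊤), (Scheme.ΓSpecIso (.of ℂ)).hom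
      ((Spec.map (CommRingCat.ofHom τ)).appTop z) = τ ((Scheme.ΓSpecIso (.of ℂ)).hom z) := by
    intro z
    have h := Scheme.ΓSpecIso_naturality (CommRingCat.ofHom τ)
    have := CategoryTheory.congr_fun (f := (Spec.map (CommRingCat.ofHom τ)).appTop ≫
      (Scheme.ΓSpecIso (.of ℂ)).hom) (g := (Scheme.ΓSpecIso (.of ℂ)).hom ≫ CommRingCat.ofHom τ) h z
    rw [CommRingCat.comp_apply, CommRingCat.comp_apply] at this
    exact this
  rw [h1, h2, h3]

/-- Values along `g ≫ π`: `(g ≫ π)^* f = g^* (π^* f)` on `Spec ℂ` (Mathlib `Scheme.Hom.comp_appLE`).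
[folklore] -/
theorem appLE_comp_eq {Z Z' : Scheme} (g : Spec (.of ℂ) ⟶ Z') (π : Z' ⟶ Z) (U : Z.Opens)
    (e : (⊤ : (Spec (.of ℂ)).Opens) ≤ (g ≫ π) ⁻¹ᵁ U) (f : Γ(Z, U)) :
    (g ≫ π).appLE U ⊤ e f = g.appLE (π ⁻¹ᵁ U) ⊤ e (π.app U f) := by
  rw [Scheme.Hom.comp_appLE, CommRingCat.comp_apply]

end SpecValues

namespace AlgPoints

variable (σ : ℂ ≃+* ℂ) (Y : SchemeOver ℂ)

/-- The projection `π : Y^σ ⟶ Y` on underlying schemes, typed on `conjugateVariety σ Y` (it is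
`baseChangeHomFst σ.toRingHom Y`, reducibly). [cite: CharlesSchnell2014Notes, §11.2.2 (11.2.1)] -/
abbrev conjFst : (conjugateVariety σ Y).left ⟶ Y.left :=
  baseChangeHomFst σ.toRingHom Y

/-- `Spec(σ⁻¹) ≫ Spec(σ) = 𝟙` for a field automorphism `σ` (functoriality of `Spec`). [folklore] -/
theorem specMap_symm_comp_specMap :
    Spec.map (CommRingCat.ofHom σ.symm.toRingHom) ≫ Spec.map (CommRingCat.ofHom σ.toRingHom) =
      𝟙 _ := by
  rw [← Spec.map_comp, ← CommRingCat.ofHom_comp]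
  have : σ.symm.toRingHom.comp σ.toRingHom = RingHom.id ℂ := by
    ext z
    simp
  rw [this, CommRingCat.ofHom_id]
  exact Spec.map_id _

/-- The structure map of `π ∘ y'` is `Spec σ`: `y' ≫ π ≫ (Y → Spec ℂ) = Spec σ` for a complex
point `y'` of `Y^σ` (the pullback square of `Y^σ`, and `y'` is over `Spec ℂ`). [folklore] -/
theorem toSpecHom_comp_conjFst_comp_hom (y' : ComplexPoints (conjugateVariety σ Y)) :
    y'.toSpecHom ≫ conjFst σ Y ≫ Y.hom = Spec.map (CommRingCat.ofHom σ.toRingHom) := by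
  have h1 : conjFst σ Y ≫ Y.hom =
      (conjugateVariety σ Y).hom ≫ Spec.map (CommRingCat.ofHom σ.toRingHom) :=
    pullback.condition
  have h2 : y'.toSpecHom ≫ (conjugateVariety σ Y).hom =
      Spec.map (CommRingCat.ofHom (algebraMap ℂ ℂ)) := Over.w y'
  rw [h1, reassoc_of% h2, Algebra.algebraMap_self, CommRingCat.ofHom_id, Spec.map_id,
    Category.id_comp]

/-- **The complex point of `Y` under a complex point of `Y^σ`**: for `y' : Spec ℂ → Y^σ` over
`Spec ℂ`, the composite `Spec ℂ —Spec(σ⁻¹)→ Spec ℂ —y'→ Y^σ —π→ Y` is a morphism over `Spec ℂ`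
(the structure map of `π ∘ y'` is `Spec σ`, which the twist `Spec(σ⁻¹)` cancels). On closed points
this is the bijection `Y^σ(ℂ) → Y(ℂ)` inverse to Charles–Schnell's `σ`.
[cite: CharlesSchnell2014Notes, §11.2.2 (11.2.1)] -/
def ofConjugate (y' : ComplexPoints (conjugateVariety σ Y)) : ComplexPoints Y :=
  AlgPoints.mk (Spec.map (CommRingCat.ofHom σ.symm.toRingHom) ≫ y'.toSpecHom ≫ conjFst σ Y) (by
    rw [Category.assoc, Category.assoc, toSpecHom_comp_conjFst_comp_hom,
      specMap_symm_comp_specMap, Algebra.algebraMap_self, CommRingCat.ofHom_id, Spec.map_id])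

variable {σ Y}

/-- The underlying morphism of `ofConjugate σ Y y'` is `Spec(σ⁻¹) ≫ y' ≫ π` (definitional). [folklore] -/
theorem toSpecHom_ofConjugate (y' : ComplexPoints (conjugateVariety σ Y)) :
    (ofConjugate σ Y y').toSpecHom =
      Spec.map (CommRingCat.ofHom σ.symm.toRingHom) ≫ y'.toSpecHom ≫ conjFst σ Y :=
  rfl

/-- The point of `Y` under `y'` is `π` of the point of `Y^σ` under `y'` (`Spec ℂ` has one point).
[folklore] -/
theorem pt_ofConjugate (y' : ComplexPoints (conjugateVariety σ Y)) :
    (ofConjugate σ Y y').pt = (conjFst σ Y).base y'.pt := by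
  have hpt : (Spec.map (CommRingCat.ofHom σ.symm.toRingHom)).base (IsLocalRing.closedPoint ℂ) =
      IsLocalRing.closedPoint ℂ :=
    Subsingleton.elim (α := PrimeSpectrum ℂ) _ _
  change (conjFst σ Y).base (y'.toSpecHom.base
      ((Spec.map (CommRingCat.ofHom σ.symm.toRingHom)).base (IsLocalRing.closedPoint ℂ))) =
    (conjFst σ Y).base (y'.toSpecHom.base (IsLocalRing.closedPoint ℂ))
  rw [hpt]

/-- `y ∈ V ↔ y' ∈ π⁻¹ V` for the point `y` of `Y` under `y'`. [folklore] -/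
theorem pt_ofConjugate_mem_iff (y' : ComplexPoints (conjugateVariety σ Y)) (V : Y.left.Opens) :
    (ofConjugate σ Y y').pt ∈ V ↔ y'.pt ∈ conjFst σ Y ⁻¹ᵁ V := by
  rw [pt_ofConjugate]
  rfl

/-- **Values of conjugated functions transform by `σ`.** For `a ∈ Γ(Y, V)` and a complex point
`y'` of `Y^σ` over `V`: `(π^* a)(y') = σ (a(y))`, `y` the point of `Y` under `y'`. (Evaluation is
pull-back to `Γ(Spec ℂ) = ℂ`; `y = π ∘ y' ∘ Spec(σ⁻¹)` and pulling back along `Spec(σ⁻¹)` is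
`σ⁻¹` on values.) [cite: CharlesSchnell2014Notes, §11.2.2 (11.2.1)] -/
theorem eval_app_conjFst (y' : ComplexPoints (conjugateVariety σ Y)) (V : Y.left.Opens)
    (h' : y'.pt ∈ conjFst σ Y ⁻¹ᵁ V) (a : Γ(Y.left, V)) :
    y'.eval (conjFst σ Y ⁻¹ᵁ V) h' ((conjFst σ Y).app V a) =
      σ ((ofConjugate σ Y y').eval V ((pt_ofConjugate_mem_iff y' V).2 h') a) := by
  have h : (ofConjugate σ Y y').pt ∈ V := (pt_ofConjugate_mem_iff y' V).2 h'
  have e : (⊤ : (Spec (.of ℂ)).Opens) ≤ (y'.toSpecHom ≫ conjFst σ Y) ⁻¹ᵁ V :=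
    (y'.preimage_eq_top h').ge
  have hy : (ofConjugate σ Y y').eval V h a = σ.symm ((Scheme.ΓSpecIso (.of ℂ)).hom
      ((y'.toSpecHom ≫ conjFst σ Y).appLE V ⊤ e a)) := by
    rw [eval_eq_appLE]
    exact ΓSpecIso_hom_appLE_specMap_comp (y'.toSpecHom ≫ conjFst σ Y) σ.symm.toRingHom V e _ a
  have hy' : y'.eval (conjFst σ Y ⁻¹ᵁ V) h' ((conjFst σ Y).app V a) =
      (Scheme.ΓSpecIso (.of ℂ)).hom ((y'.toSpecHom ≫ conjFst σ Y).appLE V ⊤ e a) := by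
    rw [eval_eq_appLE, appLE_comp_eq]
    rfl
  rw [hy, hy', RingEquiv.apply_symm_apply]

/-- Total version of `eval_app_conjFst`: `(π^* a)(y') = σ (a(y))` as total functions (both sides
vanish off `V`). [cite: CharlesSchnell2014Notes, §11.2.2 (11.2.1)] -/
theorem evalOrZero_app_conjFst (y' : ComplexPoints (conjugateVariety σ Y)) (V : Y.left.Opens)
    (a : Γ(Y.left, V)) :
    evalOrZero (conjFst σ Y ⁻¹ᵁ V) ((conjFst σ Y).app V a) y' =
      σ (evalOrZero V a (ofConjugate σ Y y')) := by
  by_cases h' : y'.pt ∈ conjFst σ Y ⁻¹ᵁ V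
  · rw [evalOrZero_of_mem _ h', evalOrZero_of_mem _ ((pt_ofConjugate_mem_iff y' V).2 h'),
      eval_app_conjFst]
  · rw [evalOrZero_of_not_mem _ h',
      evalOrZero_of_not_mem _ (fun h ↦ h' ((pt_ofConjugate_mem_iff y' V).1 h)), map_zero]

/-- The same for GLOBAL functions (`V = ⊤`, `π⁻¹ ⊤ = ⊤`): `(π^* g)(y') = σ (g(y))` — the
conjugated coefficients of an algebraic form expression (`AlgFormExpr.conj`, which applies
`(baseChangeHomFst σ.toRingHom Y).appTop`) read on points.
[cite: CharlesSchnell2014Notes, §11.2.2 (11.2.2)] -/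
theorem evalOrZero_appTop_conjFst (y' : ComplexPoints (conjugateVariety σ Y)) (g : Γ(Y.left, ⊤)) :
    evalOrZero ⊤ ((baseChangeHomFst σ.toRingHom Y).appTop g) y' =
      σ (evalOrZero ⊤ g (ofConjugate σ Y y')) :=
  evalOrZero_app_conjFst y' ⊤ g

end AlgPoints

end Literature.AlgebraicGeometry.Motives

end
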